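import Summits.HodgeConjecture.HodgeConjecture.Theorems.VHCAbelianSchemesRoadCompactPencilDesigns
import Literature.AlgebraicGeometry.Andre1996.CMHodgeClassesEllipticPowerPencils
import Literature.AlgebraicGeometry.HodgeTheory.EllipticCurvePowersHodgeClasses
import HarnessLib

/-!
# Road b02 (`VHCAbelianSchemesRoad`) × the André column — ELLIPTIC-POWER ANCHORS: Lemme 6.3.3 (ii) recorded, and `HC_CM` from the door
# and carriers for ALGEBRAIC classes on abelian varieties ISOGENOUS TO A POWER OF AN ELLIPTIC CURVE (cell-free, residual-free)

research route, not a corollary; conditional on HC_CM plus one named minimal statement.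

The tree's combined named fact for André's Lemmes 6.3.2–6.3.3 (`Andre1996.andre1996_cmHodgeClasses_algebraicallyAnchoredPencils`,
route binder `AndreAnchoredPencilsAlgebraic`, #22) records of Lemme 6.3.3 only «(iii) … dont la fibre en `s_0` soit algébrique» and
DROPS «(ii) `X_{s_0}` soit isogène à une puissance d'une courbe elliptique» (its module docstring: «NOT recorded: … 6.3.3 (ii)»). For the
carrier mechanism of PART AA/AB the dropped clause is exactly what localises the `B_min` of the `HC_CM` step: a compact pencil with a fibre
isogenous to a power `E₀^{N+1}` of an elliptic curve is SERVED there for the anchor data «elliptic-power anchors / algebraic classes», because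
on such a fibre every rational `(p,p)` class is algebraic UNCONDITIONALLY (Tate, Murasaki, van Geemen Thm. 4.3 — the tree's PROVED
`EllipticCurve.hodgeConjectureFor_of_isIsogenous_powSucc`; in print «tout cycle de Hodge sur une puissance d'une courbe elliptique est
algébrique (cf. e.g. [KuM91], § 2)»). So this file

* §0 uses the REFINED named fact `Andre1996.andre1996_cmHodgeClasses_ellipticPowerPencils` (Literature file
  `Andre1996/CMHodgeClassesEllipticPowerPencils`, statement only) — Lemmes 6.3.2–6.3.3 as in #22 PLUS clause (ii) of 6.3.3 (the pencil has a
  complex point whose fibre is, up to isomorphism of schemes, an abelian variety isogenous to a power of an elliptic curve); WEAKER than print,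
  STRONGER than #22 (proved here: `andre1996_cmHodgeClasses_algebraicallyAnchoredPencils_of_ellipticPowerPencils`); a THEOREM in print,
  entering BY NAME as a hypothesis (it is NOT a route binder of `VHCAbelianSchemesRoad`; the planner may register it);
* §1 proves that a compact pencil of abelian varieties with an elliptic-power fibre is SERVED at that fibre for the anchor data
  «`X ≅` an abelian `n`-fold isogenous to a power of an elliptic curve, `θ` a polarisation class» / «algebraic classes»
  (`hasServedFibre_compactPencil_of_ellipticPowerFibre`), hence (door ∧ carriers at those anchors) every fibrewise rational `(p,p)` class
  on it is algebraic on EVERY fibre (`mem_algebraicClasses_compactPencil_of_ellipticPowerFibre_of_anchoredCarrierAt`);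
* §2 proves **`cmHodgeHypothesisAt_of_ellipticPowerPencils_of_door_of_anchoredCarrierAt`**: the refined fact ∧ the door for `𝒪` ∧ «`𝒪`-carriers
  for rational ALGEBRAIC classes of codimension `2 ≤ p ≤ d − 2` on polarised abelian `d`-folds isogenous to a power of an elliptic curve»
  ⟹ `CMHodgeHypothesisAt B` for every `B` — `HC_CM` FROM CARRIERS FOR KNOWN (LEFSCHETZ) CYCLES ON ELLIPTIC POWERS; and with Lemme 6.3.1
  and PART AB-a §3: **`forall_hodgeConjectureFor_of_andre1996_of_ellipticPowerPencils_of_door_of_carriers`** — `HC_AV` from #21 ∧ the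
  refined fact ∧ door ∧ CM-algebraic carriers (`2p + 4 ≤ n`) ∧ elliptic-power-algebraic carriers, `HC_CM` IDLE (it is the intermediate
  conclusion), no cell of K-SR♭∃, no curve residual; twisted-door forms per `C`.

So the designs node `AbelianDesigns` of PART AB-b (ALL polarised abelian varieties) shrinks, granted clause (ii), to carriers at CM anchors
and at ELLIPTIC-POWER anchors only — countably many isogeny classes in each dimension on the elliptic side up to the choice of `E₀`, where
every served class is a LEFSCHETZ class (a polynomial in divisor classes): the find-the-sheaf problem «a semiregular (twisted) vector
bundle / perfect complex on `E₀^{N+1}` whose `p`-th twisted Chern character is `a·w + c·θᵖ` for a given product of divisor classes `w`».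

HONEST: the refined fact is a THEOREM IN PRINT vendored as a `Prop` (hypothesis by name; not formalised: Mumford's families of Hodge type for
`Res_{E⁺/ℚ} SU(V, φ)`, Baily–Borel, Bertini, Landherr); every carrier statement is OPEN and NOT implied by the Hodge conjecture; the door is
the road's binder. Nothing here says any carrier, door, `HC_CM`, `HC_AV` or HC holds. References: [cite: Andre1996Motifs, §6.3 Lemme 6.3.2 (p. 32), Lemme 6.3.3 (ii)–(iii) and proof (p. 33)]
[cite: vanGeemen1994HodgeAV, Lemma 3.7 and Thm. 4.3] [cite: Bloch1972Semiregularity, Remark (7.5)] [cite: BuchweitzFlenner2003, §5 Thm. 5.1]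
[cite: Milne1999, §7 p. 72] [cite: MoonenZarhin1999LowDim, (2.1) and Cor. 3.9].
-/

noncomputable section

open CategoryTheory CategoryTheory.Limits AlgebraicGeometry Topology

namespace Summit.HodgeConjecture.HodgeConjecture.Ring2.SemiregularRepresentatives

-- the cell's namespace repeats the summit name (`Summit.HodgeConjecture.HodgeConjecture…`), as in every `Ring2*` file
set_option linter.dupNamespace false

open Literature.AlgebraicGeometry Literature.AlgebraicGeometry.Motives
open Literature.AlgebraicGeometry.HodgeTheory
open Literature.AlgebraicTopology.SingularHomology
open Literature.Barriers.HodgeConjecture (divisorClassesSpan)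
open Literature.AlgebraicGeometry.Abdulali1994 (InvariantCyclesHoldFor)
open Literature.AlgebraicGeometry.Andre1996 (andre1996_cmAnchoredPencil andre1996_cmHodgeClasses_algebraicallyAnchoredPencils
  andre1996_cmHodgeClasses_ellipticPowerPencils IsCMAnchoredPencilFor IsAlgebraicallyAnchoredPencilFor compactPencil_dim_eq_of_iso compactPencil_irreducibleSpace_base
  compactPencil_smooth_base compactPencil_exists_abelianVariety_fiber_dim)
open Literature.AlgebraicGeometry.Milne1999 (IsOfCMType CMHodgeHypothesisAt)
open Summit.HodgeConjecture.HodgeConjecture.Ring2.Binders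
open Summit.HodgeConjecture.HodgeConjecture.Ring2.ClassTargets
open Summit.Ventures.HSemireg (ObjClass LocalVariationalHodgeFor)

/-! ## §0 The refined named fact (Literature, by name) refines #22 -/

/-- **The refined fact implies the tree's #22** (`andre1996_cmHodgeClasses_algebraicallyAnchoredPencils`): forget clause (ii).
[cite: Andre1996Motifs, Lemmes 6.3.2–6.3.3 (pp. 32–33)] -/
theorem andre1996_cmHodgeClasses_algebraicallyAnchoredPencils_of_ellipticPowerPencils
    (h : andre1996_cmHodgeClasses_ellipticPowerPencils) : andre1996_cmHodgeClasses_algebraicallyAnchoredPencils := by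
  intro B hB hCM p hp c hc hpp
  refine Submodule.span_mono ?_ (h B hB hCM p hp c hc hpp)
  rintro c' ⟨B', g, w, d, 𝒳, S, f, hpencil, -, rfl⟩
  exact ⟨B', g, w, d, 𝒳, S, f, hpencil, rfl⟩

variable {𝒪 : ObjClass} {n p : ℕ}
variable {𝒳 S : SchemeOver ℂ} {f : 𝒳 ⟶ S}

/-! ## §1 Compact pencils with an elliptic-power fibre are served there (anchors: elliptic powers; served: algebraic classes) -/

/-- **On a fibre isomorphic to an abelian variety isogenous to a power of an elliptic curve, every fibrewise rational `(p,p)` class is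
ALGEBRAIC** — unconditionally (Tate, Murasaki; van Geemen Thm. 4.3 and Lemma 3.7: the tree's PROVED
`EllipticCurve.hodgeConjectureFor_of_isIsogenous_powSucc`, moved along `e₀ : A₀.X ≅ 𝒳_{s₀}`). [cite: vanGeemen1994HodgeAV, Lemma 3.7 and Thm. 4.3]
[cite: MoonenZarhin1999LowDim, (2.1) and Cor. 3.9] -/
theorem mem_algebraicClasses_fiber_of_ellipticPower (hf : IsCompactAbelianPencil f n) {s₀ : ComplexPoints S}
    {A₀ E₀ : AbelianVariety ℂ} {N : ℕ} (hE₀ : E₀.dim = 1) (hiso : A₀.IsIsogenous (E₀.powSucc N)) (e₀ : A₀.X ≅ fiberOver f s₀)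
    (W : complexBetti 𝒳 (2 * p))
    (hW : ∀ s : ComplexPoints S, IsRationalClass (complexBetti.map (fiberι f s) (2 * p) W) ∧
      IsOfHodgeType n (fiberOver f s) (2 * p) p p (complexBetti.map (fiberι f s) (2 * p) W)) :
    complexBetti.map (fiberι f s₀) (2 * p) W ∈ algebraicClasses (fiberOver f s₀) p := by
  have hHC := (EllipticCurve.hodgeConjectureFor_of_isIsogenous_powSucc hE₀ N hiso).2 p
  rw [compactPencil_dim_eq_of_iso hf e₀] at hHC
  exact (forall_hodgeClass_mem_algebraicClasses_iff_of_iso e₀ p).1 hHC _ (hW s₀).1 (hW s₀).2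

/-- **A compact pencil of abelian varieties with a fibre isogenous to a power of an elliptic curve is SERVED there** for the anchor data
«`X ≅` an abelian `n`-fold isogenous to a power of an elliptic curve, `θ` a polarisation class» / «algebraic classes»: the relative
hyperplane class polarises every fibre and `W|_{s₀}` is algebraic by Tate–Murasaki. [cite: Andre1996Motifs, Lemme 6.3.3 (ii) (p. 33)]
[cite: vanGeemen1994HodgeAV, Thm. 4.3] [cite: VoisinHodgeI2002, Thm. 6.25, Thm. 7.10 and §7.1.2] -/
theorem hasServedFibre_compactPencil_of_ellipticPowerFibre (hf : IsCompactAbelianPencil f n) {s₀ : ComplexPoints S}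
    {A₀ E₀ : AbelianVariety ℂ} {N : ℕ} (hE₀ : E₀.dim = 1) (hiso : A₀.IsIsogenous (E₀.powSucc N)) (e₀ : A₀.X ≅ fiberOver f s₀)
    (W : complexBetti 𝒳 (2 * p))
    (hW : ∀ s : ComplexPoints S, IsRationalClass (complexBetti.map (fiberι f s) (2 * p) W) ∧
      IsOfHodgeType n (fiberOver f s) (2 * p) p p (complexBetti.map (fiberι f s) (2 * p) W)) :
    HasServedFibre n p
      (fun X θ ↦ (∃ (A₀ E₀ : AbelianVariety ℂ) (N : ℕ), A₀.dim = n ∧ E₀.dim = 1 ∧ A₀.IsIsogenous (E₀.powSucc N) ∧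
        Nonempty (A₀.X ≅ X)) ∧ IsPolarizationClass n X θ)
      (fun X _ ↦ (algebraicClasses X p : Set (complexBetti X (2 * p)))) f W := by
  haveI : IsSeparated S.hom :=
    (IsQuasiProjectiveOver.of_isProjectiveOver hf.isSmoothProjective_base.isProjectiveOver).isSeparated
  obtain ⟨Θ, hΘ⟩ := exists_forall_isPolarizationClass_map_fiberι f hf.isSmoothProjectiveFamily
    (IsQuasiProjectiveOver.of_isProjectiveOver hf.isSmoothProjective_total.isProjectiveOver)
  exact ⟨s₀, Θ, fun s ↦ (hΘ s).isRationalClass,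
    fun s ↦ isOfHodgeType_of_mem_algebraicClasses_of_isSmoothProjective (hf.isSmoothProjectiveFamily.isSmoothProjective s) 1
      (hΘ s).mem_algebraicClasses,
    ⟨⟨A₀, E₀, N, compactPencil_dim_eq_of_iso hf e₀, hE₀, hiso, ⟨e₀⟩⟩, hΘ s₀⟩,
    mem_algebraicClasses_fiber_of_ellipticPower hf hE₀ hiso e₀ W hW⟩

/-- **Door ∧ carriers at elliptic-power anchors ⟹ on every compact pencil of abelian varieties of relative dimension `n` with a fibre
isogenous to a power of an elliptic curve, every fibrewise rational `(p,p)` class is algebraic on EVERY fibre** (PART AA-f §1 fed by §1;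
`p` in the mid-range — off it every fibre is Lefschetz anyway). [cite: BuchweitzFlenner2003, §5 Thm. 5.1] [cite: Bloch1972Semiregularity, Remark (7.5)]
[cite: CharlesSchnell2014Notes, Prop. 11.3.11 (proof)] [cite: vanGeemen1994HodgeAV, Thm. 4.3] -/
theorem mem_algebraicClasses_compactPencil_of_ellipticPowerFibre_of_anchoredCarrierAt (hT : LocalVariationalHodgeFor 𝒪)
    (hcar : AnchoredCarrierAt 𝒪 n p
      (fun X θ ↦ (∃ (A₀ E₀ : AbelianVariety ℂ) (N : ℕ), A₀.dim = n ∧ E₀.dim = 1 ∧ A₀.IsIsogenous (E₀.powSucc N) ∧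
        Nonempty (A₀.X ≅ X)) ∧ IsPolarizationClass n X θ)
      (fun X _ ↦ (algebraicClasses X p : Set (complexBetti X (2 * p)))))
    (hf : IsCompactAbelianPencil f n) {s₀ : ComplexPoints S} {A₀ E₀ : AbelianVariety ℂ} {N : ℕ} (hE₀ : E₀.dim = 1)
    (hiso : A₀.IsIsogenous (E₀.powSucc N)) (e₀ : A₀.X ≅ fiberOver f s₀) (W : complexBetti 𝒳 (2 * p))
    (hW : ∀ s : ComplexPoints S, IsRationalClass (complexBetti.map (fiberι f s) (2 * p) W) ∧
      IsOfHodgeType n (fiberOver f s) (2 * p) p p (complexBetti.map (fiberι f s) (2 * p) W))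
    (s : ComplexPoints S) : complexBetti.map (fiberι f s) (2 * p) W ∈ algebraicClasses (fiberOver f s) p :=
  mem_algebraicClasses_compactPencil_of_anchoredCarrierAt_of_hasServedFibre hT hcar hf W hW
    (hasServedFibre_compactPencil_of_ellipticPowerFibre hf hE₀ hiso e₀ W hW) s

/-! ## §2 `HC_CM` from the refined fact, the door and carriers at elliptic-power anchors; `HC_AV` with `HC_CM` idle -/

/-- **`HC_CM` FROM CARRIERS FOR KNOWN CYCLES ON ELLIPTIC POWERS**: the refined fact (Lemmes 6.3.2–6.3.3 with (ii)) ∧ the door for `𝒪` ∧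
«for all `d`, `p` with `2 ≤ p ≤ d − 2`: on every `X ≅` an abelian `d`-fold isogenous to a power of an elliptic curve, for every polarisation
class `θ` and every rational ALGEBRAIC class `w` of codimension `p`, an `𝒪`-datum with `κ_p = a·w + c_p·θᵖ`, `a ≠ 0`, sides on the `θ`-ray»
⟹ `CMHodgeHypothesisAt B` for every complex abelian variety `B`. Codimension `0`, `1`: trivial / Lefschetz `(1,1)`; `p ≥ 2`: each
generator `g^*(w)` is algebraic — `W` is algebraic on the elliptic-power fibre (Tate–Murasaki), the pencil is served there, the door and
the carriers make `W` algebraic on `𝒳_{s₁}` (off the mid-range of `d`: Lefschetz directly), and `e₁`, `g'`, `q ≠ 0`, `g` bring it to `B`.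
[cite: Andre1996Motifs, §6.3 b), c), Lemme 6.3.3 (ii) (pp. 32–33)] [cite: vanGeemen1994HodgeAV, Thm. 4.3] [cite: Milne1999, §7 p. 72]
[cite: Bloch1972Semiregularity, Remark (7.5)] -/
theorem cmHodgeHypothesisAt_of_ellipticPowerPencils_of_door_of_anchoredCarrierAt (h₂₂ : andre1996_cmHodgeClasses_ellipticPowerPencils)
    (hT : LocalVariationalHodgeFor 𝒪)
    (hcar : ∀ d p : ℕ, 2 ≤ p → p + 2 ≤ d → AnchoredCarrierAt 𝒪 d p
      (fun X θ ↦ (∃ (A₀ E₀ : AbelianVariety ℂ) (N : ℕ), A₀.dim = d ∧ E₀.dim = 1 ∧ A₀.IsIsogenous (E₀.powSucc N) ∧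
        Nonempty (A₀.X ≅ X)) ∧ IsPolarizationClass d X θ)
      (fun X _ ↦ (algebraicClasses X p : Set (complexBetti X (2 * p)))))
    (B : AbelianVariety ℂ) : CMHodgeHypothesisAt B := by
  intro hB hCM
  refine (hodgeConjectureFor_iff_of_isSmoothProjective nonempty_hodgeModel_holds hB).2 ?_
  intro p c hc hpp
  by_cases hp : p ≤ 1
  · exact (mem_algebraicClasses_and_divisorClassesSpan_of_offMidRange hB (Or.inl hp) c hc hpp).1
  refine (Submodule.span_le.mpr ?_) (h₂₂ B hB hCM p (by omega) c hc hpp)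
  rintro _ ⟨B', g, w, d, 𝒳, S, f, ⟨hf, s₁, _, W, A₁, e₁, g', q, hW, hq, hgw, -⟩, ⟨s₀, A₀, E₀, N, hE₀, hiso, ⟨e₀⟩⟩, rfl⟩
  -- `W` is algebraic on the fibre `𝒳_{s₁}`: off the mid-range of `d` by Lefschetz, in it by the door and the elliptic-power carriers
  have h₁ : complexBetti.map (fiberι f s₁) (2 * p) W ∈ algebraicClasses (fiberOver f s₁) p := by
    by_cases hoff : p ≤ 1 ∨ d ≤ p + 1
    · exact (mem_algebraicClasses_and_divisorClassesSpan_of_offMidRange (hf.isSmoothProjectiveFamily.isSmoothProjective s₁) hoff _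
        (hW s₁).1 (hW s₁).2).1
    · exact mem_algebraicClasses_compactPencil_of_ellipticPowerFibre_of_anchoredCarrierAt hT (hcar d p (by omega) (by omega)) hf hE₀
        hiso e₀ W hW s₁
  -- across `e₁`, back along `g'`, divide by `q`, then back along `g`
  have h₂ : complexBetti.map e₁.hom (2 * p) (complexBetti.map (fiberι f s₁) (2 * p) W) ∈ algebraicClasses A₁.X p :=
    (mem_algebraicClasses_map_iff_of_iso e₁).2 h₁
  have h₃ : (q : ℂ) • w ∈ algebraicClasses B'.X p := by
    rw [← hgw]
    exact map_mem_algebraicClasses_of_abelianVariety AbelianVariety.isSmoothProjective_holds A₁ g'.hom.hom.hom h₂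
  have h₄ : w ∈ algebraicClasses B'.X p := (Submodule.smul_mem_iff _ (Rat.cast_ne_zero.2 hq)).1 h₃
  exact map_mem_algebraicClasses_of_abelianVariety hB B' g.hom.hom.hom h₄

/-- **`HC_AV` WITH `HC_CM` IDLE, CELL-FREE, RESIDUAL-FREE, FROM CARRIERS FOR ALGEBRAIC CLASSES AT CM AND ELLIPTIC-POWER ANCHORS ONLY**:
Lemme 6.3.1 ∧ the refined Lemmes 6.3.2–6.3.3 ∧ the door for `𝒪` ∧ CM-algebraic carriers (`2 ≤ p`, `2p + 4 ≤ n`, PART AB-a §3) ∧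
elliptic-power-algebraic carriers (`2 ≤ p ≤ d − 2`) ⟹ `∀ A, HodgeConjectureFor A.dim A.X` (`HC_CM` is the intermediate conclusion above).
[cite: Andre1996Motifs, §6.3 Lemmes 6.3.1–6.3.3 (pp. 31–33)] [cite: vanGeemen1994HodgeAV, Thm. 4.3] [cite: Bloch1972Semiregularity, Remark (7.5)]
[cite: BuchweitzFlenner2003, §5 Thm. 5.1] -/
theorem forall_hodgeConjectureFor_of_andre1996_of_ellipticPowerPencils_of_door_of_carriers (h₂₁ : andre1996_cmAnchoredPencil)
    (h₂₂ : andre1996_cmHodgeClasses_ellipticPowerPencils) (hT : LocalVariationalHodgeFor 𝒪)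
    (hcm : ∀ n p : ℕ, 2 ≤ p → 2 * p + 4 ≤ n → AnchoredCarrierAt 𝒪 n p
      (fun X θ ↦ (∃ A₀ : AbelianVariety ℂ, A₀.dim = n ∧ IsOfCMType A₀ ∧ Nonempty (A₀.X ≅ X)) ∧ IsPolarizationClass n X θ)
      (fun X _ ↦ (algebraicClasses X p : Set (complexBetti X (2 * p)))))
    (hell : ∀ d p : ℕ, 2 ≤ p → p + 2 ≤ d → AnchoredCarrierAt 𝒪 d p
      (fun X θ ↦ (∃ (A₀ E₀ : AbelianVariety ℂ) (N : ℕ), A₀.dim = d ∧ E₀.dim = 1 ∧ A₀.IsIsogenous (E₀.powSucc N) ∧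
        Nonempty (A₀.X ≅ X)) ∧ IsPolarizationClass d X θ)
      (fun X _ ↦ (algebraicClasses X p : Set (complexBetti X (2 * p))))) :
    ∀ A : AbelianVariety ℂ, HodgeConjectureFor A.dim A.X :=
  forall_hodgeConjectureFor_of_cmAnchoredPencil_of_cmHodge_of_cmAlgebraicCarrierAt h₂₁ hT
    (cmHodgeHypothesisAt_of_ellipticPowerPencils_of_door_of_anchoredCarrierAt h₂₂ hT hell) hcm

/-- **Twisted-door form of the `HC_CM` row, per `C`.** [cite: Andre1996Motifs, Lemme 6.3.3 (ii) (p. 33)] [cite: Pridham2024Semiregularity, Cor. 2.25 and Rem. 2.27]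
[cite: vanGeemen1994HodgeAV, Thm. 4.3] -/
theorem cmHodgeHypothesisAt_of_ellipticPowerPencils_of_twistedPerfectDoorVHC_of_anchoredCarrierAt {C : ChernCharacterBetti}
    {Adm : PerfectAdmissibility} (h₂₂ : andre1996_cmHodgeClasses_ellipticPowerPencils) (hT : TwistedPerfectDoorVHC C Adm)
    (hcar : ∀ d p : ℕ, 2 ≤ p → p + 2 ≤ d → AnchoredCarrierAt (twistedReflexiveClass C Adm) d p
      (fun X θ ↦ (∃ (A₀ E₀ : AbelianVariety ℂ) (N : ℕ), A₀.dim = d ∧ E₀.dim = 1 ∧ A₀.IsIsogenous (E₀.powSucc N) ∧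
        Nonempty (A₀.X ≅ X)) ∧ IsPolarizationClass d X θ)
      (fun X _ ↦ (algebraicClasses X p : Set (complexBetti X (2 * p)))))
    (B : AbelianVariety ℂ) : CMHodgeHypothesisAt B :=
  cmHodgeHypothesisAt_of_ellipticPowerPencils_of_door_of_anchoredCarrierAt h₂₂
    ((twistedPerfectDoorVHC_iff_localVariationalHodgeFor C Adm).1 hT) hcar B

/-- **Twisted-door form of the `HC_AV` row, per `C`** (`HC_CM` idle). [cite: Andre1996Motifs, §6.3 (pp. 31–33)]
[cite: Pridham2024Semiregularity, Cor. 2.25 and Rem. 2.27] [cite: vanGeemen1994HodgeAV, Thm. 4.3] -/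
theorem forall_hodgeConjectureFor_of_andre1996_of_ellipticPowerPencils_of_twistedPerfectDoorVHC_of_carriers {C : ChernCharacterBetti}
    {Adm : PerfectAdmissibility} (h₂₁ : andre1996_cmAnchoredPencil) (h₂₂ : andre1996_cmHodgeClasses_ellipticPowerPencils)
    (hT : TwistedPerfectDoorVHC C Adm)
    (hcm : ∀ n p : ℕ, 2 ≤ p → 2 * p + 4 ≤ n → AnchoredCarrierAt (twistedReflexiveClass C Adm) n p
      (fun X θ ↦ (∃ A₀ : AbelianVariety ℂ, A₀.dim = n ∧ IsOfCMType A₀ ∧ Nonempty (A₀.X ≅ X)) ∧ IsPolarizationClass n X θ)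
      (fun X _ ↦ (algebraicClasses X p : Set (complexBetti X (2 * p)))))
    (hell : ∀ d p : ℕ, 2 ≤ p → p + 2 ≤ d → AnchoredCarrierAt (twistedReflexiveClass C Adm) d p
      (fun X θ ↦ (∃ (A₀ E₀ : AbelianVariety ℂ) (N : ℕ), A₀.dim = d ∧ E₀.dim = 1 ∧ A₀.IsIsogenous (E₀.powSucc N) ∧
        Nonempty (A₀.X ≅ X)) ∧ IsPolarizationClass d X θ)
      (fun X _ ↦ (algebraicClasses X p : Set (complexBetti X (2 * p))))) :
    ∀ A : AbelianVariety ℂ, HodgeConjectureFor A.dim A.X :=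
  forall_hodgeConjectureFor_of_andre1996_of_ellipticPowerPencils_of_door_of_carriers h₂₁ h₂₂
    ((twistedPerfectDoorVHC_iff_localVariationalHodgeFor C Adm).1 hT) hcm hell

/-- **The elliptic-power carrier statement ⟸ the pinned design** (restriction of `PinnedDesignAt 𝒪 n p` to elliptic-power anchors), so the
new rows refine PART AB-a §2 (`AbelianDesigns`). [cite: Bloch1972Semiregularity, Remark (7.5)] [cite: vanGeemen1994HodgeAV, Thm. 4.3] -/
theorem ellipticPowerAlgebraicCarrierAt_of_pinnedDesignAt (h : PinnedDesignAt 𝒪 n p) :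
    AnchoredCarrierAt 𝒪 n p
      (fun X θ ↦ (∃ (A₀ E₀ : AbelianVariety ℂ) (N : ℕ), A₀.dim = n ∧ E₀.dim = 1 ∧ A₀.IsIsogenous (E₀.powSucc N) ∧
        Nonempty (A₀.X ≅ X)) ∧ IsPolarizationClass n X θ)
      (fun X _ ↦ (algebraicClasses X p : Set (complexBetti X (2 * p)))) :=
  anchoredCarrierAt_of_pinnedDesignAt h (fun _ _ hXθ ↦ ⟨by obtain ⟨⟨A₀, E₀, N, hd, -, -, he⟩, -⟩ := hXθ; exact ⟨A₀, hd, he⟩, hXθ.2⟩)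
    fun _ _ _ _ hw ↦ hw

/-- **At an elliptic-power anchor every rational `(p,p)` class is ALGEBRAIC** (so the served set «algebraic classes» there is the set of
all rational-span Hodge classes, and — Tate–Murasaki, van Geemen Thm. 4.3: `Bᵖ = Dᵖ` — consists of LEFSCHETZ classes, polynomials in divisor
classes; this lemma records the algebraicity, which is what the carrier statement consumes): on `X ≅ A₀.X` with `A₀` of dimension `n`
isogenous to `E₀^{N+1}`, `dim E₀ = 1`, the tree's PROVED `EllipticCurve.hodgeConjectureFor_of_isIsogenous_powSucc` moved along the
isomorphism. [cite: vanGeemen1994HodgeAV, Lemma 3.7 and Thm. 4.3] [cite: MoonenZarhin1999LowDim, (2.1) and Cor. 3.9] -/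
theorem mem_algebraicClasses_of_ellipticPowerAnchor {X : SchemeOver ℂ} {A₀ E₀ : AbelianVariety ℂ} {N : ℕ} (hd : A₀.dim = n)
    (hE₀ : E₀.dim = 1) (hiso : A₀.IsIsogenous (E₀.powSucc N)) (e₀ : A₀.X ≅ X) {w : complexBetti X (2 * p)} (hwQ : IsRationalClass w)
    (hw : IsOfHodgeType n X (2 * p) p p w) : w ∈ algebraicClasses X p := by
  have hHC := (EllipticCurve.hodgeConjectureFor_of_isIsogenous_powSucc hE₀ N hiso).2 p
  rw [hd] at hHC
  exact (forall_hodgeClass_mem_algebraicClasses_iff_of_iso e₀ p).1 hHC _ hwQ hw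

end Summit.HodgeConjecture.HodgeConjecture.Ring2.SemiregularRepresentatives

end
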